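import Literature.MathematicalPhysics.QuantumFieldTheory.Balaban1983to89.B7Eq47AveragedBondVsStraight
import Literature.MathematicalPhysics.QuantumFieldTheory.Balaban1983to89.B7Eq44TorusAxialGauge
import Literature.MathematicalPhysics.QuantumFieldTheory.Balaban1983to89.B9Eq315QLipschitz
import Literature.MathematicalPhysics.QuantumFieldTheory.Balaban1983to89.B9Eq315QTower

/-!
# `Balaban1983to89.B7Eq43AveragedSmallnessLevelFree` — T. Bałaban, *Averaging operations for lattice gauge theories*, Commun. Math. Phys. **98** (1985) 17–51
# [Balaban1985Averaging] (42)–(43) pp. 23–24, p. 25, Prop. 2 (52)–(54) p. 26, with [Balaban1985BackgroundPropagators] (3.15) p. 393, (3.35)–(3.37) p. 396: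
# **THE LEVEL BACKGROUNDS `Ū^j` OF A BACKGROUND WITH `ε`-SMALL BOND VARIABLES IN PRINT's PLAQUETTE CLASS (52) HAVE `(L^{n−j}ε + 256(d+1)(d+4)α₀(L^{n−j}∕N)²)`-SMALL
# BOND VARIABLES — GLOBALLY ON THE TORUS, NO GAUGE, NO LEVEL COUNT** (the AREA-count twin of `B7Eq43AveragedSmallness.norm_UlevOf_sub_one_le`, whose
# constant `(8(d+1)L)^k·ε` from bond smallness alone is exponential in the number of levels): hence the NE9 chain's displayed level-profile window
# `‖Ū^j(b) − 1‖ ≤ ε_j ≤ α′r^j` is a CONSEQUENCE of its two other windows (bonds `αη`, plaquettes `αη²`) with `r = 1∕L`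

statement-level skeleton of published theorems with citation tags; proofs where landed; nothing here is a claim about the Yang–Mills mass gap

CITATION HEADER (lean-in-tree rule).  Audit cell `pub-balaban`, sub-cell `t4`, BINDER row NE9; filed by NE9 formalisation-swarm leaf prover 03
(`b2b-balaban-t4-ne9-formalise-leaf-03`, gen 65), first brick of the WINDOW DERIVATION named by the row owner (`g85/TOWER-R-PROGRAMME.md` §3 (a) ∕ §5,
owner g86 ONLINE: «the small-field WINDOWS stay hypotheses (their derivation = the gauge step, leaves 03∕05)»).  Sources READ in the held text:
[Balaban1985Averaging] pp. 23–26 (quoted in `B7Prop2Explicit` ∕ `B7Eq47AveragedBondVsStraight`), [Balaban1985BackgroundPropagators] pp. 393, 396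
(`paper:balaban1985-cmp99-background-propagators` p0005, p0008).  Objects BY NAME: the owner's `towerP` ∕ `UlevOf`, the chain's `plaqHolU`, the
lit-balaban cell's `pdev` ∕ `avgIter` ∕ `AvgClosed` ∕ `perCfg` ∕ `hol` ∕ `seg`, `B9Eq315QLipschitz.norm_hol_sub_one_le`, this lineage's
`B7Eq47AveragedBondVsStraight.norm_avgIter_sub_straight_le` (gen 64, (T1)); nothing re-declared, 0 `def`.

THE PRINT (verbatim).  [B7] p. 24 (43): *«Ū^{k} = \overline{(Ū^{k−1})}»*; p. 25: *«|V₀(Γ_{c,x}) − 1| < |Γ_{c,x}|dLα₀»* (a transporter of `|Γ|` bonds each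
`ε`-close to `1` is `|Γ|ε`-close to `1`); p. 26 (52): *«|U(∂p) − 1| < α₀η², η = L^{−k}»*, (53)–(54): the averaged configurations stay in the class.  [B9] p. 393
(3.15): the level backgrounds of `Q_k(U)`; p. 396 (3.35)–(3.37): the small-field class and the profile of the averaged configurations over the domains `Ω_j`.

WHAT IS PROVED (sorry-free; proof lane — 0 `def`; [folklore] composition of landed letters + torus bookkeeping).
* §1 `pdev_perCfg_le_of_plaq` — torus plaquette variables `δ`-close to `1` ⇒ `pdev Ũ ≤ δ` for the periodic extension; `UlevOf_mem` — every level
  background of an `S`-valued `U` in the class is `S`-valued (ALL `j`, junk levels included; private `norm_UlevOf_sub_one_le_two`).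
* §2 **`norm_UlevOf_sub_one_le_area`** — for `U : Bond(T_{L^{n+1}m}) → S` (`S` averaging-closed), `C₀α₀ ≤ ⅓`, `2α₀ ≤ c₂′`, `pdev Ũ < α₀N⁻²` (`N = L^{n+1}`) and
  `‖U(b) − 1‖ ≤ ε` at EVERY fine bond: for `j ≤ n` and EVERY level-`(j+1)` bond `b`,
  `‖(UlevOf L m (n+1) U j) b − 1‖ ≤ L^{n−j}·ε + 256(d+1)(d+4)·α₀·(L^{n−j}∕N)²` — LENGTH (the straight transporter of `L^{n−j}` fine bonds,
  `norm_hol_sub_one_le`) + AREA ((T1) `norm_avgIter_sub_straight_le`); no gauge, no `2 ≤ m_i`, no block restriction, NO level count;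
  **`norm_UlevOf_sub_one_le_profile`** — with `ε = α·N⁻¹`: `≤ (α + 256(d+1)(d+4)α₀)·L^{n−j}∕N = ((α + 256(d+1)(d+4)α₀)∕L)·L^{−j}`.
* §3 **`exists_profile_of_windows`** — THE CHAIN's BINDER PACKAGE: under §2's hypotheses there is `εU : ℕ → ℝ` with `0 ≤ εU j`,
  `‖(UlevOf U j) b − 1‖ ≤ εU j` for ALL `j, b`, and `εU j ≤ ((α + 256(d+1)(d+4)α₀)∕L)·(1∕L)^j` for `j < n+1` — the three displays `hεU ∕ hUε ∕ hεg` of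
  `B9Thm311SmallFieldCoercivityTowerDiagonal ∕ …Closed ∕ B9Thm311LaplaceAkPositiveDiagonal` INHABITED with `r = 1∕L`;
  **`exists_profile_of_windows_eta`** — the same read in the chain's currency on print's diagonal `ηL^{n+1} = 1`: from `‖U(b) − 1‖ ≤ αη` (all bonds),
  `‖U(∂p) − 1‖ ≤ αη²` (all torus plaquettes), `0 ≤ α < α₀`.
WHY (cell context).  The NE9 chain's k-level Thm 3.11 files display THREE small-field windows: fine bonds `αη`, plaquettes `αη²`, level averages
`ε_j ≤ αr^j`.  The third is NOT independent: it follows from the first two, level-free, by the AREA count — this file; the sequel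
`B9Thm311SmallFieldCoercivityTowerTwoWindows` re-issues the owner's closed `∃`-theorems with the third window struck.  What is NOT derivable this way
(and is not claimed): the fine-bond window from the plaquette window GLOBALLY on the torus (non-contractible holonomies; print's (3.35) is a PER-CUBE gauge
statement — the IMS ∕ localisation road of ROUTES-NE9 R2′ B8′).
HONEST SCOPE.  [folklore]; nothing of [B7] Prop. 2 ∕ [B9] asserted hypothesis-free (the class (52) and the bond window are hypotheses); NOT summit progress
(cell pub-balaban: NE9 NOT PRINTED ∕ NOT PROVED; «NE9 ⇐ the named binders»; spine PROVED 0/9; rung (B)+1 finite T⁴ — NOT infinite volume, NOT mass gap,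
NOT Clay; HONEST DEPENDENCY: continuum YM on T⁴ ⇐ BetaPertH ∧ nine spine estimates (0/9 proved); BetaPertH ⇐ (D1) ∧ (D4) ∧ CAP+tail; G-an2-4 gates
asym, D1 and NE2/3/4).  NEW file; nothing modified.  Net new unproved facts: 0.
-/

noncomputable section

open scoped BigOperators

namespace Literature.MathematicalPhysics.QuantumFieldTheory.Balaban1983to89.B7Eq43AveragedSmallnessLevelFree

open B4Sect5Torus (TSite)
open B9SectCLatticeCarrier (Bond)
open B7Prop1Explicit (hol seg U1 mem_U1 hol_mem plaqWord length_seg hol_seg_succ seg_zero hol_nil)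
open B7Prop2Explicit (pdev le_pdev avgIter C0 c2' AvgClosed avgIter_mem hol_plaqWord_self)
open B9Eq315QTorus (perCfg perCfg_apply)
open B9Eq315QTorusOnto (liftSite perSite_liftSite)
open B9Eq315QTower (towerP UlevOf)
open B9Eq310DeltaPrime (plaqHolU)
open B7Eq44TorusAxialGauge (plaqSmall_perCfg)
open B7Eq47AveragedBondVsStraight (norm_avgIter_sub_straight_le)

variable {d : ℕ} (L : ℕ) [NeZero L] (m : Fin d → ℕ) [∀ i, NeZero (m i)] (n : ℕ)

/-! ## §1 The plaquette letter of the periodic extension; the level backgrounds stay in the class -/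

section Class

variable {𝔸 : Type*} [NormedRing 𝔸] [NormOneClass 𝔸]

omit [NeZero L] in
/-- **torus plaquettes `δ`-close to `1` ⇒ `pdev Ũ ≤ δ`** for the periodic extension `Ũ = perCfg P U` of a unit-bounded background (both orientations
of every `ℤ^d` unit plaquette are torus plaquette variables or their inverses; the degenerate words `p_{μμ}` are `1`). [cite: Balaban1985Averaging, (44) p.24, (52) p.26] -/
theorem pdev_perCfg_le_of_plaq {P : Fin d → ℕ} [∀ i, NeZero (P i)] {U : Bond d P → 𝔸ˣ} (hU1 : ∀ b, U b ∈ U1 𝔸) {δ : ℝ} (hδ0 : 0 ≤ δ)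
    (hδ : ∀ p : B9SectCLatticeCarrier.Plaq d P, ‖(plaqHolU U p : 𝔸) - 1‖ ≤ δ) : pdev (perCfg P U) ≤ δ := by
  unfold pdev
  refine Real.iSup_le (fun p => ?_) hδ0
  rcases eq_or_ne p.2.1 p.2.2 with h | h
  · have h1 : hol (perCfg P U) p.1 (plaqWord p.2.1 p.2.2) = 1 := by rw [h]; exact hol_plaqWord_self _ _ _
    rw [h1, Units.val_one, sub_self, norm_zero]; exact hδ0
  · exact plaqSmall_perCfg P hU1 hδ p.1 p.2.1 p.2.2 h

variable [NormedAlgebra ℂ 𝔸] [CompleteSpace 𝔸] (hL : 2 ≤ L) {S : Subgroup 𝔸ˣ} (hS : AvgClosed d L S)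
  {U : Bond d (towerP L m (n + 1)) → 𝔸ˣ} (hU : ∀ b, U b ∈ S) {α₀ : ℝ} (hα : 0 < α₀) (hα3 : C0 d * α₀ ≤ 1 / 3) (hα2 : 2 * α₀ ≤ c2' d L)
  (h52 : pdev (perCfg (towerP L m (n + 1)) U) < α₀ * (((L : ℝ) ^ (n + 1))⁻¹) ^ 2)

include hL hS hU hα hα3 hα2 h52 in
/-- **every level background is `S`-valued** (`j ≤ n`: `B7Prop2Explicit.avgIter_mem` — Prop. 2's closure (53)–(54); `j > n`: the junk level reads `Ũ`
itself). [cite: Balaban1985Averaging, Prop. 2 (52)–(54) p.26; Balaban1985BackgroundPropagators, (3.15) p.393] -/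
theorem UlevOf_mem (j : ℕ) (b : Bond d (towerP L m (j + 1))) : UlevOf L m (n + 1) U j b ∈ S := by
  have hVS : ∀ (x : B7Prop1Explicit.Site d) (μ : Fin d), perCfg (towerP L m (n + 1)) U x μ ∈ S := fun x μ => by
    rw [perCfg_apply]; exact hU _
  have h := avgIter_mem L hL hS (n + 1) (perCfg (towerP L m (n + 1)) U) hVS hα hα3 hα2 h52 (n + 1 - 1 - j) (by omega) (liftSite b.1) b.2
  rw [UlevOf]
  exact h

include hL hS hU hα hα3 hα2 h52 in
/-- Hence every level bond variable is unit-bounded and `‖Ū^j(b) − 1‖ ≤ 2`. [folklore] -/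
private theorem norm_UlevOf_sub_one_le_two (j : ℕ) (b : Bond d (towerP L m (j + 1))) : ‖(UlevOf L m (n + 1) U j b : 𝔸) - 1‖ ≤ 2 := by
  have h1 : ‖(UlevOf L m (n + 1) U j b : 𝔸)‖ ≤ 1 := (mem_U1.1 (hS.le_U1 (UlevOf_mem L m n hL hS hU hα hα3 hα2 h52 j b))).1
  calc ‖(UlevOf L m (n + 1) U j b : 𝔸) - 1‖ ≤ ‖(UlevOf L m (n + 1) U j b : 𝔸)‖ + ‖(1 : 𝔸)‖ := norm_sub_le _ _
    _ ≤ 1 + 1 := add_le_add h1 (by rw [norm_one])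
    _ = 2 := by norm_num

end Class

/-! ## §2 LENGTH + AREA, globally on the torus -/

section Area

variable {𝔸 : Type*} [NormedRing 𝔸] [NormOneClass 𝔸] [NormedAlgebra ℂ 𝔸] [CompleteSpace 𝔸] (hL : 2 ≤ L) {S : Subgroup 𝔸ˣ} (hS : AvgClosed d L S)
  {U : Bond d (towerP L m (n + 1)) → 𝔸ˣ} (hU : ∀ b, U b ∈ S) {α₀ : ℝ} (hα : 0 < α₀) (hα3 : C0 d * α₀ ≤ 1 / 3) (hα2 : 2 * α₀ ≤ c2' d L)
  (h52 : pdev (perCfg (towerP L m (n + 1)) U) < α₀ * (((L : ℝ) ^ (n + 1))⁻¹) ^ 2)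

include hL hS hU hα hα3 hα2 h52 in
/-- **THE LEVEL BONDS FROM THE BOND WINDOW AND THE CLASS (52), LEVEL-FREE**: if every fine bond variable is `ε`-close to `1`, then for `j ≤ n` and every
level-`(j+1)` bond `b`, `‖(UlevOf L m (n+1) U j) b − 1‖ ≤ L^{n−j}·ε + 256(d+1)(d+4)·α₀·(L^{n−j}∕N)²`, `N = L^{n+1}` — the straight transporter of
`L^{n−j}` fine bonds (LENGTH, p. 25) plus the deviation of the `(n−j)`-fold average (43) from it (AREA, (T1)).  No gauge, no restriction on the bond,
no level count. [cite: Balaban1985Averaging, (42)–(43) pp.23–24, p.25, Prop. 2 (52)–(54) p.26; Balaban1985BackgroundPropagators, (3.15) p.393, (3.35)–(3.37) p.396] -/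
theorem norm_UlevOf_sub_one_le_area {ε : ℝ} (hε : ∀ b, ‖(U b : 𝔸) - 1‖ ≤ ε) {j : ℕ} (hj : j ≤ n) (b : Bond d (towerP L m (j + 1))) :
    ‖(UlevOf L m (n + 1) U j b : 𝔸) - 1‖ ≤
      (L : ℝ) ^ (n - j) * ε + 256 * (d + 1) * (d + 4) * α₀ * ((L : ℝ) ^ (n - j) * ((L : ℝ) ^ (n + 1))⁻¹) ^ 2 := by
  set V := perCfg (towerP L m (n + 1)) U with hV
  have hVS : ∀ (x : B7Prop1Explicit.Site d) (μ : Fin d), V x μ ∈ S := fun x μ => by rw [hV, perCfg_apply]; exact hU _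
  have hVU1 : ∀ (x : B7Prop1Explicit.Site d) (μ : Fin d), V x μ ∈ U1 𝔸 := fun x μ => hS.le_U1 (hVS x μ)
  have hVε : ∀ (x : B7Prop1Explicit.Site d) (μ : Fin d), ‖(V x μ : 𝔸) - 1‖ ≤ ε := fun x μ => by rw [hV, perCfg_apply]; exact hε _
  -- LENGTH: the straight transporter of `L^{n−j}` fine bonds
  have hlen : ‖((hol V (((L : ℤ) ^ (n - j)) • liftSite b.1) (seg b.2 ((L ^ (n - j) : ℕ) : ℤ)) : 𝔸ˣ) : 𝔸) - 1‖ ≤ (L : ℝ) ^ (n - j) * ε := by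
    have h := B9Eq315QLipschitz.norm_hol_sub_one_le hVU1 hVε (((L : ℤ) ^ (n - j)) • liftSite b.1) (seg b.2 ((L ^ (n - j) : ℕ) : ℤ))
    rw [length_seg, Int.natAbs_natCast] at h
    have hc : ((L ^ (n - j) : ℕ) : ℝ) = (L : ℝ) ^ (n - j) := by push_cast; rfl
    rwa [hc] at h
  -- AREA: the averaged bond against the straight transporter ((T1), `n − j ≤ n + 1` steps)
  have harea := norm_avgIter_sub_straight_le L hL hS (n + 1) V hVS hα hα3 hα2 h52 (n - j) (by omega) (liftSite b.1) b.2
  have hU' : UlevOf L m (n + 1) U j b = avgIter L V (n - j) (liftSite b.1) b.2 := by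
    rw [UlevOf, show n + 1 - 1 - j = n - j by omega]
  rw [hU']
  calc ‖((avgIter L V (n - j) (liftSite b.1) b.2 : 𝔸ˣ) : 𝔸) - 1‖
      ≤ ‖((avgIter L V (n - j) (liftSite b.1) b.2 : 𝔸ˣ) : 𝔸) - ((hol V (((L : ℤ) ^ (n - j)) • liftSite b.1) (seg b.2 ((L ^ (n - j) : ℕ) : ℤ)) : 𝔸ˣ) : 𝔸)‖ +
          ‖((hol V (((L : ℤ) ^ (n - j)) • liftSite b.1) (seg b.2 ((L ^ (n - j) : ℕ) : ℤ)) : 𝔸ˣ) : 𝔸) - 1‖ := norm_sub_le_norm_sub_add_norm_sub _ _ _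
    _ ≤ 256 * (d + 1) * (d + 4) * α₀ * ((L : ℝ) ^ (n - j) * ((L : ℝ) ^ (n + 1))⁻¹) ^ 2 + (L : ℝ) ^ (n - j) * ε := add_le_add harea hlen
    _ = _ := by ring

include hL hS hU hα hα3 hα2 h52 in
/-- **THE PROFILE, LEVEL-FREE**: with the fine window `‖U(b) − 1‖ ≤ α·N⁻¹` (`N = L^{n+1}`; print's `αη` at `ηN = 1`), for `j ≤ n` and every level-`(j+1)`
bond, `‖(UlevOf U j) b − 1‖ ≤ (α + 256(d+1)(d+4)α₀)·(L^{n−j}∕N)` (`(L^{n−j}∕N)² ≤ L^{n−j}∕N`) — ratio `1∕L` per level towards the coarse end: `j = n`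
(finest) `C∕N`, `j = 0` (coarsest) `C∕L`. [cite: Balaban1985Averaging, pp.24–26, (52)–(54); Balaban1985BackgroundPropagators, (3.37) p.396] -/
theorem norm_UlevOf_sub_one_le_profile {α : ℝ} (hε : ∀ b, ‖(U b : 𝔸) - 1‖ ≤ α * ((L : ℝ) ^ (n + 1))⁻¹) {j : ℕ} (hj : j ≤ n)
    (b : Bond d (towerP L m (j + 1))) :
    ‖(UlevOf L m (n + 1) U j b : 𝔸) - 1‖ ≤ (α + 256 * (d + 1) * (d + 4) * α₀) * ((L : ℝ) ^ (n - j) * ((L : ℝ) ^ (n + 1))⁻¹) := by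
  have h := norm_UlevOf_sub_one_le_area L m n hL hS hU hα hα3 hα2 h52 hε hj b
  have hL0 : (0 : ℝ) < L := by exact_mod_cast lt_of_lt_of_le (by norm_num) hL
  have hN : (0 : ℝ) < (L : ℝ) ^ (n + 1) := pow_pos hL0 _
  set r : ℝ := (L : ℝ) ^ (n - j) * ((L : ℝ) ^ (n + 1))⁻¹ with hr
  have hr0 : 0 ≤ r := by rw [hr]; positivity
  have hr1 : r ≤ 1 := by
    rw [hr, ← div_eq_mul_inv, div_le_one hN]
    exact pow_le_pow_right₀ (by exact_mod_cast le_trans (by norm_num) hL) (by omega)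
  have e1 : (L : ℝ) ^ (n - j) * (α * ((L : ℝ) ^ (n + 1))⁻¹) = α * r := by rw [hr]; ring
  have h2 : 256 * (d + 1) * (d + 4) * α₀ * r ^ 2 ≤ 256 * (d + 1) * (d + 4) * α₀ * r := by
    have : r ^ 2 ≤ r := by nlinarith
    exact mul_le_mul_of_nonneg_left this (by positivity)
  rw [e1] at h
  calc _ ≤ α * r + 256 * (d + 1) * (d + 4) * α₀ * r := h.trans (add_le_add le_rfl h2)
    _ = (α + 256 * (d + 1) * (d + 4) * α₀) * r := by ring

end Area

/-! ## §3 The chain's binder package `(εU, hεU, hUε, hεg)` with `r = 1∕L` -/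

section Package

variable {𝔸 : Type*} [NormedRing 𝔸] [NormOneClass 𝔸] [NormedAlgebra ℂ 𝔸] [CompleteSpace 𝔸] (hL : 2 ≤ L) {S : Subgroup 𝔸ˣ} (hS : AvgClosed d L S)
  {U : Bond d (towerP L m (n + 1)) → 𝔸ˣ} (hU : ∀ b, U b ∈ S) {α₀ : ℝ} (hα : 0 < α₀) (hα3 : C0 d * α₀ ≤ 1 / 3) (hα2 : 2 * α₀ ≤ c2' d L)

include hL hS hU hα hα3 hα2 in
/-- **THE LEVEL-PROFILE WINDOW INHABITED FROM THE BOND WINDOW AND THE CLASS (52)**: under `pdev Ũ < α₀N⁻²` and `‖U(b) − 1‖ ≤ αN⁻¹` there is a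
profile `εU : ℕ → ℝ`, `0 ≤ εU j`, bounding EVERY level bond variable (`‖(UlevOf U j) b − 1‖ ≤ εU j` for all `j`, `b` — junk levels `j > n` by `2`), with
`εU j ≤ ((α + 256(d+1)(d+4)α₀)∕L)·(1∕L)^j` for `j < n+1` — the displays `hεU`, `hUε`, `hεg : ∀ j < n+1, εU j ≤ α′r^j` of the NE9 chain's k-level files
at `r = 1∕L`, `α′ = (α + 256(d+1)(d+4)α₀)∕L`. [cite: Balaban1985Averaging, (42)–(43) pp.23–24, Prop. 2 (52)–(54) p.26; Balaban1985BackgroundPropagators, (3.35)–(3.37) p.396] -/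
theorem exists_profile_of_windows (h52 : pdev (perCfg (towerP L m (n + 1)) U) < α₀ * (((L : ℝ) ^ (n + 1))⁻¹) ^ 2) {α : ℝ} (hα0 : 0 ≤ α)
    (hε : ∀ b, ‖(U b : 𝔸) - 1‖ ≤ α * ((L : ℝ) ^ (n + 1))⁻¹) :
    ∃ εU : ℕ → ℝ, (∀ j, 0 ≤ εU j) ∧ (∀ (j : ℕ) (b : Bond d (towerP L m (j + 1))), ‖(UlevOf L m (n + 1) U j b : 𝔸) - 1‖ ≤ εU j) ∧
      ∀ j < n + 1, εU j ≤ (α + 256 * (d + 1) * (d + 4) * α₀) / L * (1 / (L : ℝ)) ^ j := by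
  have hL0 : (0 : ℝ) < L := by exact_mod_cast lt_of_lt_of_le (by norm_num) hL
  obtain ⟨B, hBdef⟩ : ∃ B : ℝ, B = α + 256 * (d + 1) * (d + 4) * α₀ := ⟨_, rfl⟩
  have hB0 : 0 ≤ B := by rw [hBdef]; positivity
  refine ⟨fun j => if j ≤ n then B / L * (1 / (L : ℝ)) ^ j else 2, fun j => ?_, fun j b => ?_, fun j hj => ?_⟩
  · by_cases hj : j ≤ n
    · simp only [hj, if_true]; positivity
    · simp only [hj, if_false]; norm_num
  · by_cases hj : j ≤ n
    · simp only [hj, if_true]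
      have h := norm_UlevOf_sub_one_le_profile L m n hL hS hU hα hα3 hα2 h52 hε hj b
      rw [← hBdef] at h
      have e : (L : ℝ) ^ (n - j) * ((L : ℝ) ^ (n + 1))⁻¹ = 1 / L * (1 / (L : ℝ)) ^ j := by
        have hsplit : (L : ℝ) ^ (n + 1) = (L : ℝ) ^ (n - j) * (L : ℝ) ^ (j + 1) := by rw [← pow_add]; congr 1; omega
        rw [hsplit, mul_inv, ← mul_assoc, mul_inv_cancel₀ (pow_ne_zero _ hL0.ne'), one_mul, pow_succ, mul_inv, one_div, inv_pow, mul_comm]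
      rw [e, ← mul_assoc, ← div_eq_mul_one_div] at h
      exact h
    · simp only [hj, if_false]
      exact norm_UlevOf_sub_one_le_two L m n hL hS hU hα hα3 hα2 h52 j b
  · have hj' : j ≤ n := by omega
    simp only [hj', if_true]
    rw [hBdef]

include hL hS hU hα hα3 hα2 in
/-- **THE SAME IN THE CHAIN's CURRENCY ON PRINT's DIAGONAL `ηL^{n+1} = 1`**: from the two windows of (3.35) read on the torus — bonds `‖U(b) − 1‖ ≤ αη`,
plaquettes `‖U(∂p) − 1‖ ≤ αη²` — with `0 ≤ α < α₀` (`C₀α₀ ≤ ⅓`, `2α₀ ≤ c₂′`), the level-profile window with `r = 1∕L`: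
`∃ εU ≥ 0`, `‖(UlevOf U j) b − 1‖ ≤ εU j` (all `j, b`), `εU j ≤ ((α + 256(d+1)(d+4)α₀)∕L)·(1∕L)^j` (`j < n+1`).  The fine-bond window itself is NOT
derived here (torus holonomies; print's (3.35) is per cube). [cite: Balaban1985BackgroundPropagators, (3.35)–(3.37) p.396, (3.15) p.393; Balaban1985Averaging, Prop. 2 (52)–(54) p.26] -/
theorem exists_profile_of_windows_eta {η : ℝ} (hηL : η * (L : ℝ) ^ (n + 1) = 1) {α : ℝ} (hα0 : 0 ≤ α) (hαlt : α < α₀)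
    (hUη : ∀ b, ‖(U b : 𝔸) - 1‖ ≤ α * η) (hpl : ∀ p : B9SectCLatticeCarrier.Plaq d (towerP L m (n + 1)), ‖(plaqHolU U p : 𝔸) - 1‖ ≤ α * η ^ 2) :
    ∃ εU : ℕ → ℝ, (∀ j, 0 ≤ εU j) ∧ (∀ (j : ℕ) (b : Bond d (towerP L m (j + 1))), ‖(UlevOf L m (n + 1) U j b : 𝔸) - 1‖ ≤ εU j) ∧
      ∀ j < n + 1, εU j ≤ (α + 256 * (d + 1) * (d + 4) * α₀) / L * (1 / (L : ℝ)) ^ j := by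
  have hL0 : (0 : ℝ) < L := by exact_mod_cast lt_of_lt_of_le (by norm_num) hL
  have hN : (0 : ℝ) < (L : ℝ) ^ (n + 1) := pow_pos hL0 _
  have hη : η = ((L : ℝ) ^ (n + 1))⁻¹ := (inv_eq_of_mul_eq_one_left hηL).symm
  have hU1 : ∀ b, U b ∈ U1 𝔸 := fun b => hS.le_U1 (hU b)
  have hpd : pdev (perCfg (towerP L m (n + 1)) U) ≤ α * η ^ 2 := pdev_perCfg_le_of_plaq (U := U) hU1 (by positivity) hpl
  have h52 : pdev (perCfg (towerP L m (n + 1)) U) < α₀ * (((L : ℝ) ^ (n + 1))⁻¹) ^ 2 := by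
    refine lt_of_le_of_lt hpd ?_
    rw [hη]
    exact mul_lt_mul_of_pos_right hαlt (by positivity)
  have hε : ∀ b, ‖(U b : 𝔸) - 1‖ ≤ α * ((L : ℝ) ^ (n + 1))⁻¹ := fun b => by rw [← hη]; exact hUη b
  exact exists_profile_of_windows L m n hL hS hU hα hα3 hα2 h52 hα0 hε

end Package

end Literature.MathematicalPhysics.QuantumFieldTheory.Balaban1983to89.B7Eq43AveragedSmallnessLevelFree

end
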